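import Mathlib
import Summits.Ventures.HodgeRepro2.T5MeasureSupOnClopens
import Summits.Ventures.HodgeRepro2.T5PropGArithmetic

/-!
# T5MuInvariantPadic — the μ-invariant of a `ℤ_p`-valued measure on a profinite space, in the
  valuation vocabulary of T5PropGArithmetic rows 6–8: «inf over opens = inf over `C(Γ⁻, ℤ_p)`»,
  and `μ(ν̃·m) = μ(m)`

Tier-5 support of seat p7 (route/T5-CHECK-G-p7.md §3 S4; route/T5-LEAN-p7.md §56).

`X` profinite (`Γ⁻`), `m : C(X, ℤ_p) →ₗ[ℤ_p] ℤ_p` bounded (an «𝒪-valued measure», `C = 1`),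
`vp : ℤ_p → ℕ∞` the `p`-adic valuation with `vp 0 = ⊤` (the `v` of rows 6–8).
* `mu m := ⨅ U clopen, vp (m 1_U)` — the prose's «μ = inf over opens»;
* `iInf_vp_apply_eq_mu` — **«inf over opens = inf over C(Γ⁻, 𝒪)»**: `⨅ φ, vp (m φ) = mu m`
  (from T5MeasureSupOnClopens.norm_apply_le_of_forall_indicator_le through
  `‖x‖ ≤ p^{−n} ↔ n ≤ vp x`);
* `mu_eq_top_iff` — `mu m = ⊤ ↔ m(1_U) = 0` for every clopen `U` (row 6's `mu_eq_top_iff`), and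
  `mu_eq_top_iff_eq_zero` — `mu m = ⊤ ↔ m = 0` (S1's «μ(φ) = ∞ ⟺ φ = 0», by density);
* `mu_twist` — **«μ(ν̃·m) = μ(m)»** for a continuous `ν` with continuous inverse (row 8's
  `mu_twist_invariant` for the bijection `φ ↦ νφ` of `C(X, ℤ_p)`, then the first theorem).

Nothing about Katz measures, p-adic L-functions or Iwasawa algebras is asserted.
Axioms: standard.  README §8(d): uses an L-value-free non-vanishing device: NO.
-/

namespace Summit.Ventures.HodgeRepro2.T5MuInvariantPadic

open Set T5LocallyConstantDense T5MeasureSupOnClopens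

variable (p : ℕ) [hp : Fact (Nat.Prime p)]

section Valuation

open Classical in
/-- The `p`-adic valuation on `ℤ_p` with `vp 0 = ⊤` (rows 6–8's `v`, with `v a = ⊤ ↔ a = 0`). -/
noncomputable def vp (x : ℤ_[p]) : ℕ∞ := if x = 0 then ⊤ else (x.valuation : ℕ∞)

/-- `vp 0 = ⊤`. -/
theorem vp_zero : vp p (0 : ℤ_[p]) = ⊤ := by
  simp [vp]

/-- `vp x = x.valuation` for `x ≠ 0`. -/
theorem vp_of_ne_zero {x : ℤ_[p]} (hx : x ≠ 0) : vp p x = (x.valuation : ℕ∞) := by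
  simp [vp, hx]

/-- `vp x = ⊤ ↔ x = 0`. -/
theorem vp_eq_top_iff (x : ℤ_[p]) : vp p x = ⊤ ↔ x = 0 := by
  by_cases hx : x = 0
  · simp [hx, vp_zero]
  · rw [vp_of_ne_zero p hx]
    simp [hx]

/-- **The dictionary norm ↔ valuation**: `‖x‖ ≤ p^{−n} ↔ n ≤ vp x` (Mathlib's
`PadicInt.norm_le_pow_iff_le_valuation` for `x ≠ 0`; both sides hold for `x = 0`). -/
theorem norm_le_pow_iff (x : ℤ_[p]) (n : ℕ) : ‖x‖ ≤ (p : ℝ) ^ (-(n : ℤ)) ↔ (n : ℕ∞) ≤ vp p x := by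
  by_cases hx : x = 0
  · subst hx
    rw [vp_zero, norm_zero]
    have : (0 : ℝ) ≤ (p : ℝ) ^ (-(n : ℤ)) := by positivity
    exact ⟨fun _ => le_top, fun _ => this⟩
  · rw [vp_of_ne_zero p hx, ENat.coe_le_coe]
    exact PadicInt.norm_le_pow_iff_le_valuation x hx n

/-- `a ≤ b` in `ℕ∞` once every natural number below `a` is below `b`. -/
theorem le_of_forall_natCast_le {a b : ℕ∞} (h : ∀ n : ℕ, (n : ℕ∞) ≤ a → (n : ℕ∞) ≤ b) : a ≤ b := by
  induction a using ENat.recTopCoe with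
  | top =>
    rw [ENat.eq_top_iff_forall_ge.mpr fun n => h n le_top]
  | coe n => exact h n le_rfl

end Valuation

section Mu

variable {X : Type*} [TopologicalSpace X]

/-- **The μ-invariant** of `m`: `inf_U vp (m 1_U)` over the clopen sets `U` («inf over opens»). -/
noncomputable def mu (m : C(X, ℤ_[p]) →ₗ[ℤ_[p]] ℤ_[p]) : ℕ∞ :=
  ⨅ U : {U : Set X // IsClopen U}, vp p (m (indicatorCM U.1))

/-- `mu m ≤ vp (m 1_U)` for every clopen `U`. -/
theorem mu_le (m : C(X, ℤ_[p]) →ₗ[ℤ_[p]] ℤ_[p]) {U : Set X} (hU : IsClopen U) :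
    mu p m ≤ vp p (m (indicatorCM U)) :=
  iInf_le (fun U : {U : Set X // IsClopen U} => vp p (m (indicatorCM U.1))) ⟨U, hU⟩

/-- `mu m = ⊤ ↔ m 1_U = 0` for every clopen `U` (row 6's `mu_eq_top_iff`). -/
theorem mu_eq_top_iff (m : C(X, ℤ_[p]) →ₗ[ℤ_[p]] ℤ_[p]) :
    mu p m = ⊤ ↔ ∀ U : Set X, IsClopen U → m (indicatorCM U) = 0 := by
  rw [mu, T5PropGArithmetic.mu_eq_top_iff (vp p) (vp_eq_top_iff p)]
  exact ⟨fun h U hU => h ⟨U, hU⟩, fun h U => h U.1 U.2⟩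

variable [CompactSpace X] [T2Space X] [TotallyDisconnectedSpace X]

/-- The level form: if `n ≤ vp (m 1_U)` for every clopen `U` then `n ≤ vp (m φ)` for every
continuous `φ` (T5MeasureSupOnClopens.norm_apply_le_of_forall_indicator_le with `S = p^{−n}`). -/
theorem natCast_le_vp_apply (m : C(X, ℤ_[p]) →ₗ[ℤ_[p]] ℤ_[p]) {C : ℝ} (hC : 0 ≤ C)
    (hm : ∀ φ, ‖m φ‖ ≤ C * ‖φ‖) (n : ℕ)
    (h : ∀ U : Set X, IsClopen U → (n : ℕ∞) ≤ vp p (m (indicatorCM U))) (φ : C(X, ℤ_[p])) :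
    (n : ℕ∞) ≤ vp p (m φ) := by
  rw [← norm_le_pow_iff]
  have hS : (0 : ℝ) ≤ (p : ℝ) ^ (-(n : ℤ)) := by positivity
  exact norm_apply_le_of_forall_indicator_le PadicInt.norm_le_one m hC hm hS
    (fun U hU => (norm_le_pow_iff p _ n).mpr (h U hU)) φ

/-- **S1's «φ = 0 ⟺ φ(U) = 0 for every open U»**: a bounded measure vanishing on every clopen
indicator is zero (density: `‖m φ‖ ≤ 0`). -/
theorem eq_zero_of_forall_indicator_eq_zero (m : C(X, ℤ_[p]) →ₗ[ℤ_[p]] ℤ_[p]) {C : ℝ} (hC : 0 ≤ C)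
    (hm : ∀ φ, ‖m φ‖ ≤ C * ‖φ‖) (h : ∀ U : Set X, IsClopen U → m (indicatorCM U) = 0) : m = 0 := by
  ext φ
  rw [LinearMap.zero_apply, ← norm_le_zero_iff]
  exact norm_apply_le_of_forall_indicator_le PadicInt.norm_le_one m hC hm le_rfl
    (fun U hU => by rw [h U hU, norm_zero]) φ

/-- `mu m = ⊤ ↔ m = 0` for a bounded measure (S1: «μ(φ) = ∞ ⟺ φ = 0»). -/
theorem mu_eq_top_iff_eq_zero (m : C(X, ℤ_[p]) →ₗ[ℤ_[p]] ℤ_[p]) {C : ℝ} (hC : 0 ≤ C)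
    (hm : ∀ φ, ‖m φ‖ ≤ C * ‖φ‖) : mu p m = ⊤ ↔ m = 0 := by
  rw [mu_eq_top_iff]
  exact ⟨eq_zero_of_forall_indicator_eq_zero p m hC hm, fun h U _ => by rw [h, LinearMap.zero_apply]⟩

/-- **«inf over opens = inf over C(Γ⁻, 𝒪)»**: `⨅ φ, vp (m φ) = mu m`. -/
theorem iInf_vp_apply_eq_mu (m : C(X, ℤ_[p]) →ₗ[ℤ_[p]] ℤ_[p]) {C : ℝ} (hC : 0 ≤ C)
    (hm : ∀ φ, ‖m φ‖ ≤ C * ‖φ‖) : (⨅ φ : C(X, ℤ_[p]), vp p (m φ)) = mu p m := by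
  apply le_antisymm
  · apply le_iInf
    intro U
    exact iInf_le (fun φ : C(X, ℤ_[p]) => vp p (m φ)) (indicatorCM U.1)
  · apply le_iInf
    intro φ
    apply le_of_forall_natCast_le
    intro n hn
    exact natCast_le_vp_apply p m hC hm n (fun U hU => hn.trans (mu_le p m hU)) φ

end Mu

section Twist

variable {X : Type*} [TopologicalSpace X]

/-- Multiplication by `ν` with continuous inverse `ν'` is a bijection of `C(X, ℤ_p)`
(«φ ↦ φν̃ is a bijection of C(Γ⁻, 𝒪)»). -/
noncomputable def mulLeftEquiv (ν ν' : C(X, ℤ_[p])) (h : ν * ν' = 1) : C(X, ℤ_[p]) ≃ C(X, ℤ_[p]) where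
  toFun φ := ν * φ
  invFun φ := ν' * φ
  left_inv φ := by
    show ν' * (ν * φ) = φ
    rw [← mul_assoc, mul_comm ν' ν, h, one_mul]
  right_inv φ := by
    show ν * (ν' * φ) = φ
    rw [← mul_assoc, h, one_mul]

/-- `mulLeftEquiv ν ν' h φ = ν * φ`. -/
@[simp] theorem mulLeftEquiv_apply (ν ν' : C(X, ℤ_[p])) (h : ν * ν' = 1) (φ : C(X, ℤ_[p])) :
    mulLeftEquiv p ν ν' h φ = ν * φ := rfl

/-- The twist does not change the infimum over `C(X, ℤ_p)` (row 8's `mu_twist_invariant`). -/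
theorem iInf_vp_twist (ν ν' : C(X, ℤ_[p])) (h : ν * ν' = 1) (m : C(X, ℤ_[p]) →ₗ[ℤ_[p]] ℤ_[p]) :
    (⨅ φ : C(X, ℤ_[p]), vp p (twist ν m φ)) = ⨅ φ : C(X, ℤ_[p]), vp p (m φ) := by
  have := T5PropGArithmetic.mu_twist_invariant (fun φ : C(X, ℤ_[p]) => vp p (m φ))
    (mulLeftEquiv p ν ν' h)
  simpa only [mulLeftEquiv_apply, twist_apply] using this

variable [CompactSpace X] [T2Space X] [TotallyDisconnectedSpace X]

/-- **«μ(ν̃·m) = μ(m)»** (S4): the μ-invariant is unchanged by the twist by a continuous `ν` with a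
continuous inverse. -/
theorem mu_twist (ν ν' : C(X, ℤ_[p])) (h : ν * ν' = 1) (m : C(X, ℤ_[p]) →ₗ[ℤ_[p]] ℤ_[p]) {C : ℝ}
    (hC : 0 ≤ C) (hm : ∀ φ, ‖m φ‖ ≤ C * ‖φ‖) : mu p (twist ν m) = mu p m := by
  rw [← iInf_vp_apply_eq_mu p (twist ν m) hC (twist_bound PadicInt.norm_le_one ν m hC hm),
    iInf_vp_twist p ν ν' h, iInf_vp_apply_eq_mu p m hC hm]

end Twist

end Summit.Ventures.HodgeRepro2.T5MuInvariantPadic
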